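import Summits.QuantumFields.YangMills.Theorems.ComplexCouplingChannelFreeEnergyWindowChannelTransportCriterion

/-!
# Regime split of symmetric-torus zero-freeness: reach ∧ local ⇒ `TorusZeroFreeChannel` (⇒ the crux)

Crux `FreeEnergyWindowChannel` (stmt-QuantumFields-18842, route `ComplexCouplingChannel` of `QuantumFields/YangMills`),
line `Sketch` (transport form).  By the transport criterion (`freeEnergyWindowChannel_iff_torusZeroFree`, file
`…TransportCriterion.lean`) the crux is equivalent to the bare zero-freeness statement T: an anchor-connected open
connected channel to every large real `β` on which the symmetric-torus Wilson partition functions `Z_P`, `P ≥ P₀`, have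
no zeros.  Zero-freeness is a POINTWISE property, so — unlike free-energy windows, which need their holomorphic `f`'s
patched — zero-free open sets simply UNITE (with the larger `P₀`).  Hence T splits by coupling regime with a trivial
glue (`torusZeroFree_of_reach_of_local`):

* REACH (global, the non-abelian input): for every threshold `b` a zero-free open connected channel from `0` to SOME real
  `βs ≥ b`;
* LOCAL (weak coupling): beyond some `β₁`, around EVERY real `t ≥ β₁` a complex disc free of zeros of all `Z_P`,
  `P ≥ P₀(t)` (no volume-stable accumulation of symmetric-torus Fisher zeros at large real coupling);

and `freeEnergyWindowChannel_of_reach_of_local` records REACH → LOCAL → crux.  These are the zero-freeness-only shadows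
of the tree line `regime-cut`'s stubs S3 / S1+S2 (`Cruxes/FreeEnergyWindowChannel/Lines/regime_cut.lean`) and of the
v7 envelope line's `stub_reachEnvelope` / `stub_localEnvelope` (`Lines/Sketch_v7_envelope.lean`): every `f`, `M`,
floor and envelope clause there is now unnecessary.
-/

open Complex Metric Set Filter Topology

namespace Summit.QuantumFields.YangMills.Theorems.FreeEnergyWindowChannel

/-- **Uniting zero-free sets along a real segment (abstract glue).**  A zero-free open connected channel `D₀ ∋ 0, βs`
for the family `Z P` (`P ≥ P₀`) and zero-free discs around every real point of `[β, βs]` (each with its own `P₁`) give a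
zero-free open connected channel containing `0` and `β`: finitely many of the discs cover the compact segment, their
union with the segment is connected (every disc meets the connected segment), it meets `D₀` at `βs`, and the threshold
is the largest of the finitely many.  No property of `Z` is used. [folklore] -/
theorem exists_zeroFree_channel_of_reach_of_local (Z : ℕ → ℂ → ℂ) {β βs : ℝ} (hββs : β ≤ βs)
    {D₀ : Set ℂ} (hD₀o : IsOpen D₀) (hD₀c : IsConnected D₀) (h0 : (0 : ℂ) ∈ D₀) (hβs : (βs : ℂ) ∈ D₀)
    {P₀ : ℕ} (hfree₀ : ∀ P : ℕ, P₀ ≤ P → ∀ z ∈ D₀, Z P z ≠ 0)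
    (hloc : ∀ t ∈ Icc β βs, ∃ δ : ℝ, 0 < δ ∧ ∃ P₁ : ℕ, ∀ P : ℕ, P₁ ≤ P → ∀ z ∈ ball (t : ℂ) δ, Z P z ≠ 0) :
    ∃ D : Set ℂ, IsOpen D ∧ IsConnected D ∧ (0 : ℂ) ∈ D ∧ (β : ℂ) ∈ D ∧
      ∃ P₂ : ℕ, ∀ P : ℕ, P₂ ≤ P → ∀ z ∈ D, Z P z ≠ 0 := by
  classical
  choose! δ hδ P₁ hP₁ using hloc
  -- the compact connected segment `S = [β, βs] ⊆ ℂ`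
  set S : Set ℂ := (fun t : ℝ => (t : ℂ)) '' Icc β βs with hS
  have hSc : IsCompact S := isCompact_Icc.image continuous_ofReal
  have hSconn : IsConnected S := (isConnected_Icc hββs).image _ continuous_ofReal.continuousOn
  have hβS : (β : ℂ) ∈ S := ⟨β, ⟨le_rfl, hββs⟩, rfl⟩
  have hβsS : (βs : ℂ) ∈ S := ⟨βs, ⟨hββs, le_rfl⟩, rfl⟩
  have hSre : ∀ z ∈ S, z.re ∈ Icc β βs ∧ ((z.re : ℝ) : ℂ) = z := by
    rintro _ ⟨t, ht, rfl⟩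
    exact ⟨by simpa using ht, by simp⟩
  -- a finite subcover of `S` by the local discs
  obtain ⟨F, hFS, hcover⟩ := hSc.elim_nhds_subcover (fun z => ball z (δ z.re)) fun z hz => by
    refine ball_mem_nhds z (hδ z.re (hSre z hz).1)
  set W : Set ℂ := ⋃ z ∈ F, ball z (δ z.re) with hW
  have hSW : S ⊆ W := hcover
  have hWo : IsOpen W := isOpen_biUnion fun _ _ => isOpen_ball
  -- `W` is connected: every disc meets the connected segment `S ⊆ W`
  have hWconn : IsConnected W := by
    refine ⟨⟨(β : ℂ), hSW hβS⟩, isPreconnected_of_forall (β : ℂ) fun y hy => ?_⟩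
    obtain ⟨z, hzF, hyz⟩ := mem_iUnion₂.1 hy
    have hzS : z ∈ S := hFS z hzF
    have hzball : z ∈ ball z (δ z.re) := mem_ball_self (hδ z.re (hSre z hzS).1)
    refine ⟨ball z (δ z.re) ∪ S, union_subset (subset_iUnion₂ (s := fun z _ => ball z (δ z.re)) z hzF) hSW,
      Or.inr hβS, Or.inl hyz, ?_⟩
    exact IsPreconnected.union z hzball hzS (convex_ball _ _).isPreconnected hSconn.isPreconnected
  -- the channel
  refine ⟨D₀ ∪ W, hD₀o.union hWo, hD₀c.union ⟨(βs : ℂ), hβs, hSW hβsS⟩ hWconn, Or.inl h0, Or.inr (hSW hβS),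
    max P₀ (F.sup fun z => P₁ z.re), fun P hP z hz => ?_⟩
  rcases hz with hz | hz
  · exact hfree₀ P ((le_max_left _ _).trans hP) z hz
  · obtain ⟨w, hwF, hzw⟩ := mem_iUnion₂.1 hz
    have hwS : w ∈ S := hFS w hwF
    have hPw : P₁ w.re ≤ P :=
      le_trans (le_trans (Finset.le_sup (f := fun z => P₁ z.re) hwF) (le_max_right _ _)) hP
    exact hP₁ w.re (hSre w hwS).1 P hPw z (by simpa [(hSre w hwS).2] using hzw)

/-- **Regime split of symmetric-torus zero-freeness** (REACH ∧ LOCAL ⇒ T).  If for every `(G, r)` (i) for every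
threshold `b` some real `βs ≥ b` is joined to `0` by an open connected channel on which the `Z_P`, `P ≥ P₀`, have no
zeros (REACH), and (ii) beyond some `β₁` every real `t ≥ β₁` is the centre of a complex disc free of zeros of the
`Z_P`, `P ≥ P₀(t)` (LOCAL), then the zero-freeness statement T of the transport criterion holds (with `x := 0` for
every `ρ`): reach past `β`, then unite the local discs along `[β, βs]`
(`exists_zeroFree_channel_of_reach_of_local`). -/
theorem torusZeroFree_of_reach_of_local
    (hR : ∀ (G : Type) [Group G] [TopologicalSpace G] [IsTopologicalGroup G] [CompactSpace G] [MeasurableSpace G] [BorelSpace G], Literature.MathematicalPhysics.QuantumFieldTheory.IsCompactSimpleLieGroup G → ∀ r : Literature.MathematicalPhysics.QuantumFieldTheory.LatticeRep G,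
      ∀ b : ℝ, ∃ βs : ℝ, b ≤ βs ∧ ∃ D : Set ℂ, IsOpen D ∧ IsConnected D ∧ (0 : ℂ) ∈ D ∧ (βs : ℂ) ∈ D ∧
        ∃ P₀ : ℕ, ∀ P : ℕ, P₀ ≤ P → ∀ z ∈ D,
          Literature.MathematicalPhysics.QuantumFieldTheory.wilsonFinTorusPartitionC r.ρ z P P P P ≠ 0)
    (hL : ∀ (G : Type) [Group G] [TopologicalSpace G] [IsTopologicalGroup G] [CompactSpace G] [MeasurableSpace G] [BorelSpace G], Literature.MathematicalPhysics.QuantumFieldTheory.IsCompactSimpleLieGroup G → ∀ r : Literature.MathematicalPhysics.QuantumFieldTheory.LatticeRep G,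
      ∃ β₁ : ℝ, ∀ t : ℝ, β₁ ≤ t → ∃ δ : ℝ, 0 < δ ∧ ∃ P₀ : ℕ, ∀ P : ℕ, P₀ ≤ P → ∀ z ∈ ball (t : ℂ) δ,
        Literature.MathematicalPhysics.QuantumFieldTheory.wilsonFinTorusPartitionC r.ρ z P P P P ≠ 0) :
    ∀ (G : Type) [Group G] [TopologicalSpace G] [IsTopologicalGroup G] [CompactSpace G] [MeasurableSpace G] [BorelSpace G], Literature.MathematicalPhysics.QuantumFieldTheory.IsCompactSimpleLieGroup G → ∀ r : Literature.MathematicalPhysics.QuantumFieldTheory.LatticeRep G,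
      ∃ β₁ : ℝ, ∀ β : ℝ, β₁ ≤ β → ∀ ρ : ℝ, 0 < ρ →
        ∃ D : Set ℂ, IsOpen D ∧ IsConnected D ∧ (β : ℂ) ∈ D ∧ (∃ x : ℝ, |x| < ρ ∧ (x : ℂ) ∈ D) ∧
          ∃ P₀ : ℕ, ∀ P : ℕ, P₀ ≤ P → ∀ z ∈ D,
            Literature.MathematicalPhysics.QuantumFieldTheory.wilsonFinTorusPartitionC r.ρ z P P P P ≠ 0 := by
  intro G _ _ _ _ _ _ hG r
  obtain ⟨β₁, hloc⟩ := hL G hG r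
  refine ⟨β₁, fun β hβ ρ hρ => ?_⟩
  obtain ⟨βs, hββs, D₀, hD₀o, hD₀c, h0, hβs, P₀, hfree₀⟩ := hR G hG r β
  obtain ⟨D, hDo, hDc, h0D, hβD, P₂, hfree⟩ :=
    exists_zeroFree_channel_of_reach_of_local
      (fun P z => Literature.MathematicalPhysics.QuantumFieldTheory.wilsonFinTorusPartitionC r.ρ z P P P P) hββs
      hD₀o hD₀c h0 hβs hfree₀ (fun t ht => hloc t (hβ.trans ht.1))
  exact ⟨D, hDo, hDc, hβD, ⟨0, by simpa using hρ, by simpa using h0D⟩, P₂, hfree⟩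

/-- **REACH → LOCAL → crux**: the regime split composed with the transport criterion
(`freeEnergyWindowChannel_iff_torusZeroFree`).  A planner may re-line the crux on these two zero-freeness-only
physics statements; every analysis step in between is landed. -/
theorem freeEnergyWindowChannel_of_reach_of_local
    (hR : ∀ (G : Type) [Group G] [TopologicalSpace G] [IsTopologicalGroup G] [CompactSpace G] [MeasurableSpace G] [BorelSpace G], Literature.MathematicalPhysics.QuantumFieldTheory.IsCompactSimpleLieGroup G → ∀ r : Literature.MathematicalPhysics.QuantumFieldTheory.LatticeRep G,
      ∀ b : ℝ, ∃ βs : ℝ, b ≤ βs ∧ ∃ D : Set ℂ, IsOpen D ∧ IsConnected D ∧ (0 : ℂ) ∈ D ∧ (βs : ℂ) ∈ D ∧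
        ∃ P₀ : ℕ, ∀ P : ℕ, P₀ ≤ P → ∀ z ∈ D,
          Literature.MathematicalPhysics.QuantumFieldTheory.wilsonFinTorusPartitionC r.ρ z P P P P ≠ 0)
    (hL : ∀ (G : Type) [Group G] [TopologicalSpace G] [IsTopologicalGroup G] [CompactSpace G] [MeasurableSpace G] [BorelSpace G], Literature.MathematicalPhysics.QuantumFieldTheory.IsCompactSimpleLieGroup G → ∀ r : Literature.MathematicalPhysics.QuantumFieldTheory.LatticeRep G,
      ∃ β₁ : ℝ, ∀ t : ℝ, β₁ ≤ t → ∃ δ : ℝ, 0 < δ ∧ ∃ P₀ : ℕ, ∀ P : ℕ, P₀ ≤ P → ∀ z ∈ ball (t : ℂ) δ,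
        Literature.MathematicalPhysics.QuantumFieldTheory.wilsonFinTorusPartitionC r.ρ z P P P P ≠ 0) :
    Summit.QuantumFields.YangMills.Theses.ComplexCouplingChannel.FreeEnergyWindowChannel :=
  freeEnergyWindowChannel_iff_torusZeroFree.2 (torusZeroFree_of_reach_of_local hR hL)

/-- **Registered stub `stub_torusZeroFreeRegime` of line `Sketch`** (= `torusZeroFree_of_reach_of_local`, the name under
which the lead's skeleton consumes it): REACH → LOCAL → T. -/
theorem stub_torusZeroFreeRegime :
    (∀ (G : Type) [Group G] [TopologicalSpace G] [IsTopologicalGroup G] [CompactSpace G] [MeasurableSpace G] [BorelSpace G], Literature.MathematicalPhysics.QuantumFieldTheory.IsCompactSimpleLieGroup G → ∀ r : Literature.MathematicalPhysics.QuantumFieldTheory.LatticeRep G,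
      ∀ b : ℝ, ∃ βs : ℝ, b ≤ βs ∧ ∃ D : Set ℂ, IsOpen D ∧ IsConnected D ∧ (0 : ℂ) ∈ D ∧ ((βs : ℝ) : ℂ) ∈ D ∧
        ∃ P₀ : ℕ, ∀ P : ℕ, P₀ ≤ P → ∀ z ∈ D,
          Literature.MathematicalPhysics.QuantumFieldTheory.wilsonFinTorusPartitionC r.ρ z P P P P ≠ 0) →
    (∀ (G : Type) [Group G] [TopologicalSpace G] [IsTopologicalGroup G] [CompactSpace G] [MeasurableSpace G] [BorelSpace G], Literature.MathematicalPhysics.QuantumFieldTheory.IsCompactSimpleLieGroup G → ∀ r : Literature.MathematicalPhysics.QuantumFieldTheory.LatticeRep G,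
      ∃ β₁ : ℝ, ∀ t : ℝ, β₁ ≤ t → ∃ δ : ℝ, 0 < δ ∧ ∃ P₀ : ℕ, ∀ P : ℕ, P₀ ≤ P → ∀ z ∈ Metric.ball ((t : ℝ) : ℂ) δ,
        Literature.MathematicalPhysics.QuantumFieldTheory.wilsonFinTorusPartitionC r.ρ z P P P P ≠ 0) →
    ∀ (G : Type) [Group G] [TopologicalSpace G] [IsTopologicalGroup G] [CompactSpace G] [MeasurableSpace G] [BorelSpace G], Literature.MathematicalPhysics.QuantumFieldTheory.IsCompactSimpleLieGroup G → ∀ r : Literature.MathematicalPhysics.QuantumFieldTheory.LatticeRep G,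
      ∃ β₁ : ℝ, ∀ β : ℝ, β₁ ≤ β → ∀ ρ : ℝ, 0 < ρ →
        ∃ D : Set ℂ, IsOpen D ∧ IsConnected D ∧ (β : ℂ) ∈ D ∧ (∃ x : ℝ, |x| < ρ ∧ (x : ℂ) ∈ D) ∧
          ∃ P₀ : ℕ, ∀ P : ℕ, P₀ ≤ P → ∀ z ∈ D,
            Literature.MathematicalPhysics.QuantumFieldTheory.wilsonFinTorusPartitionC r.ρ z P P P P ≠ 0 :=
  torusZeroFree_of_reach_of_local

end Summit.QuantumFields.YangMills.Theorems.FreeEnergyWindowChannel
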